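/-
Copyright (c) 2026 the pub-hodgecm-mathlib formalisation cell (harness21).  Prover seat hodgecm-mathlib-K2E1-p10 (g4), Track B «K2-LIT»,
hLiu418 = stmt-HodgeConjecture-24832, road `K2_Liu`, organ F4 (G-gen), road (E) (LEAD F0P6-plan M-158r; F4 lead K2Liu-p27 M-158s), brick (E-a1) sub-brick (B1+B2):
THE TWO-MATRIX SUBSTITUTION `x ↦ x·M`, `y ↦ y·Nᵀ` — multiplicativity, base change, and bidegree scaling.  2026-09-04.
-/
import Summits.HodgeConjecture.HodgeConjecture.Theorems.K2LiuUnitaryPolySubstDefs   -- ★ (E-a0) `polySubst`, `substFun`, `bideg`, `IsGLInvariant`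
import HarnessLib

/-!
# Crux `HLiu418`, organ F4 (G-gen), road (E), brick (E-a1) sub-brick (B1+B2): the TWO-MATRIX substitution `σ_{M,N}` (`x ↦ x·M`, `y ↦ y·Nᵀ`) on
# `K[x_{ia}, y_{ja}]` — `σ_g = σ_{g, (g⁻¹)ᵀ}`, multiplicativity, BASE CHANGE along ring maps, and the bidegree scaling (`Theorems/K2LiuPolySubstTwoMatrix.lean`)

Cell `hodgecm-mathlib`, crux item hLiu418 = `stmt-HodgeConjecture-24832`; squad K2 ∕ K2Liu; F4 lead K2Liu-p27 (g2) (M-158s (1) 2026-09-04T23:03:11Z: (E-a1)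
`K2LiuUnitaryZariskiDensity` «polynomial-identity transfer `U(p) → GL_p(ℂ)`» → K2Liu-p26 (g2) ∕ K2E1-p10 (g4) after (E-a0)); road memo
`K2/K2E1-p10/g4/CENSUS-Ea1-UnitaryZariskiDensity.K2E1-p10-g4.md` (road (B): Cayley + clearing denominators + `MvPolynomial.funext_set` over the real points).
THEOREMS + two definitions with bodies (`substFun₂`, `polySubst₂`); no instance, no notation, no named-fact hypothesis, no `sorry`;
lane `--kind definition --supports stmt-HodgeConjecture-24832 --as helper`.  Generic commutative ring `K`.

WHY.  Road (B) for (E-a1) needs the action `σ_g` of ★ (E-a0) `K2LiuUnitaryPolySubstDefs.polySubst` WITHOUT the inverse: the substitution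
**`σ_{M,N}` = `polySubst₂ M N`** by an ARBITRARY pair of matrices (`x ↦ x·M`, `y ↦ y·Nᵀ`), so that `σ_g = σ_{g, (g⁻¹)ᵀ}` (§1, definitional) and the
coefficients of `σ_{M,N} f` are POLYNOMIAL in the entries of `(M, N)`.  The usable form of «polynomial in `(M, N)`» is the BASE-CHANGE law (§3): for every
ring map `φ : K →+* K'`, `map φ (σ_{M,N} f) = σ_{φ(M), φ(N)} (map φ f)` — apply it with `K := MvPolynomial (entries) ℂ` (generic matrices) and `φ := eval` at a
point.  Clearing the denominator `g⁻¹ = (det g)⁻¹ • adjugate g` is done with MULTIPLICATIVITY (§2: `σ_{M M′, N N′} = σ_{M,N} ∘ σ_{M′,N′}`) and the DIAGONAL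
SCALING (§4): on a polynomial of bidegree `(d, e)`, `σ_{c•1, c′•1}` acts by `c^d · c′^e`, hence `σ_{c•M, c′•N} f = (c^d c′^e) • σ_{M,N} f`.
* §1 `substFun₂`, **`polySubst₂`**, `polySubst₂_X(_inl∕_inr)`, `polySubst₂_C`, **`polySubst_eq_polySubst₂ : polySubst g = polySubst₂ ↑g (↑g⁻¹)ᵀ`**;
* §2 **`polySubst₂_mul : polySubst₂ (M * M′) (N * N′) = (polySubst₂ M N).comp (polySubst₂ M′ N′)`**, `polySubst₂_one`;
* §3 `map_substFun₂`, **`map_polySubst₂ : MvPolynomial.map φ (polySubst₂ M N f) = polySubst₂ (M.map φ) (N.map φ) (MvPolynomial.map φ f)`**;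
* §4 **`polySubst₂_scalar_of_isWeightedHomogeneous`** (`σ_{c•1, c′•1} f = (c^d * c′^e) • f` for `f` of bidegree `(d,e)`) and
  **`polySubst₂_smul_of_isWeightedHomogeneous`** (`σ_{c•M, c′•N} f = (c^d * c′^e) • σ_{M,N} f`).
References: [Weyl1939] H. Weyl, *The Classical Groups* (1939; 2nd ed. 1946), Thm. 2.6.A, Chap. VIII §11 (unitarian trick); [Howe1989Remarks] R. Howe, Trans. AMS 313
(1989), §2; [KashiwaraVergne1978] Invent. Math. 44 (1978), §II.
HONEST LABEL.  Count-neutral helper (substitution bookkeeping; no invariant theory): `HC_CM` is proved only modulo the 7 printed citations (2 remaining named inputs: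
hLiu418 = `stmt-HodgeConjecture-24832`, h413 = `stmt-HodgeConjecture-24833`) until rung 0 closes.  NOT here: the Cayley algebra (B3), the assembly (B4) = (E-a1)'s HEAD.

## Tree search
★ (E-a0) `K2LiuUnitaryPolySubstDefs` (`polySubst`, `substFun_inl∕_inr`, `bideg`); Mathlib `MvPolynomial.aeval`, `aeval_X`, `MvPolynomial.algHom_ext`,
`MvPolynomial.induction_on`, `map_X`, `map_C`, `Matrix.map_apply`, `Matrix.mul_apply`, `IsWeightedHomogeneous`, `Finsupp.weight_apply`, `monomial_eq`,
`MvPolynomial.as_sum`.  Dedup: `rg "polySubst₂|substFun₂"` over `Theorems/` + `Literature/` — none.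
-/

set_option autoImplicit false
set_option linter.dupNamespace false -- the mandated namespace repeats `HodgeConjecture.HodgeConjecture`

noncomputable section

open MvPolynomial Matrix
open Summit.HodgeConjecture.HodgeConjecture.Cruxes.HLiu418.K2LiuUnitaryPolySubstDefs

namespace Summit.HodgeConjecture.HodgeConjecture.Cruxes.HLiu418.K2LiuPolySubstTwoMatrix

variable {K : Type*} [CommRing K] {p : ℕ}

/-! ## §1 The two-matrix substitution `σ_{M,N}`: `x ↦ x·M`, `y ↦ y·Nᵀ` -/

/-- **The substituted variables for a pair of matrices**: `x_{ia} ↦ Σ_b x_{ib} M_{ba}`, `y_{ja} ↦ Σ_b y_{jb} N_{ba}` (no inverse anywhere).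
[cite: Weyl1939, Thm. 2.6.A] [cite: Howe1989Remarks, §2] -/
def substFun₂ (M N : Matrix (Fin p) (Fin p) K) : (Fin 2 × Fin p) ⊕ (Fin 2 × Fin p) → MvPolynomial ((Fin 2 × Fin p) ⊕ (Fin 2 × Fin p)) K
  | Sum.inl (i, a) => ∑ b, X (Sum.inl (i, b)) * C (M b a)
  | Sum.inr (j, a) => ∑ b, X (Sum.inr (j, b)) * C (N b a)

/-- `substFun₂` on a vector coordinate. [folklore] -/
theorem substFun₂_inl (M N : Matrix (Fin p) (Fin p) K) (i : Fin 2) (a : Fin p) :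
    substFun₂ M N (Sum.inl (i, a)) = ∑ b, X (Sum.inl (i, b)) * C (M b a) := rfl

/-- `substFun₂` on a covector coordinate. [folklore] -/
theorem substFun₂_inr (M N : Matrix (Fin p) (Fin p) K) (j : Fin 2) (a : Fin p) :
    substFun₂ M N (Sum.inr (j, a)) = ∑ b, X (Sum.inr (j, b)) * C (N b a) := rfl

/-- **THE TWO-MATRIX SUBSTITUTION `σ_{M,N}`** (`x ↦ x·M`, `y ↦ y·Nᵀ`), a `K`-algebra endomorphism for EVERY pair `(M, N)` — invertible or not.
[cite: Weyl1939, Thm. 2.6.A] [cite: Howe1989Remarks, §2] -/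
def polySubst₂ (M N : Matrix (Fin p) (Fin p) K) :
    MvPolynomial ((Fin 2 × Fin p) ⊕ (Fin 2 × Fin p)) K →ₐ[K] MvPolynomial ((Fin 2 × Fin p) ⊕ (Fin 2 × Fin p)) K :=
  aeval (substFun₂ M N)

/-- `σ_{M,N}` on a variable. [folklore] -/
theorem polySubst₂_X (M N : Matrix (Fin p) (Fin p) K) (v : (Fin 2 × Fin p) ⊕ (Fin 2 × Fin p)) :
    polySubst₂ M N (X v) = substFun₂ M N v :=
  aeval_X _ v

/-- `σ_{M,N} (x_{ia}) = Σ_b x_{ib} M_{ba}`. [folklore] -/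
theorem polySubst₂_X_inl (M N : Matrix (Fin p) (Fin p) K) (i : Fin 2) (a : Fin p) :
    polySubst₂ M N (X (Sum.inl (i, a))) = ∑ b, X (Sum.inl (i, b)) * C (M b a) :=
  aeval_X _ _

/-- `σ_{M,N} (y_{ja}) = Σ_b y_{jb} N_{ba}`. [folklore] -/
theorem polySubst₂_X_inr (M N : Matrix (Fin p) (Fin p) K) (j : Fin 2) (a : Fin p) :
    polySubst₂ M N (X (Sum.inr (j, a))) = ∑ b, X (Sum.inr (j, b)) * C (N b a) :=
  aeval_X _ _

/-- `σ_{M,N}` on constants. [folklore] -/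
theorem polySubst₂_C (M N : Matrix (Fin p) (Fin p) K) (r : K) : polySubst₂ M N (C r) = C r :=
  (polySubst₂ M N).commutes r

/-- ★ (E-a0)'s `substFun g` is `substFun₂ g (g⁻¹)ᵀ` (definitionally). [folklore] -/
theorem substFun_eq_substFun₂ (g : GL (Fin p) K) :
    substFun g = substFun₂ (g : Matrix (Fin p) (Fin p) K) ((g⁻¹ : GL (Fin p) K) : Matrix (Fin p) (Fin p) K)ᵀ := by
  funext v
  rcases v with ⟨i, a⟩ | ⟨j, a⟩
  · rfl
  · rfl

/-- **`σ_g = σ_{g, (g⁻¹)ᵀ}`** — the action of ★ (E-a0) is the two-matrix substitution at the pair `(g, (g⁻¹)ᵀ)`. [cite: Weyl1939, Thm. 2.6.A] -/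
theorem polySubst_eq_polySubst₂ (g : GL (Fin p) K) :
    polySubst g = polySubst₂ (g : Matrix (Fin p) (Fin p) K) ((g⁻¹ : GL (Fin p) K) : Matrix (Fin p) (Fin p) K)ᵀ := by
  show aeval (substFun g) = aeval _
  rw [substFun_eq_substFun₂]

/-! ## §2 Multiplicativity -/

/-- **`σ_{M M′, N N′} = σ_{M,N} ∘ σ_{M′,N′}`** (substitution of a right action anti-composes; twin of ★ `polySubst_mul`). [folklore] -/
theorem polySubst₂_mul (M M' N N' : Matrix (Fin p) (Fin p) K) :
    polySubst₂ (M * M') (N * N') = (polySubst₂ M N).comp (polySubst₂ M' N') := by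
  refine MvPolynomial.algHom_ext fun v => ?_
  rw [AlgHom.comp_apply, polySubst₂_X, polySubst₂_X]
  rcases v with ⟨i, a⟩ | ⟨j, a⟩
  · rw [substFun₂_inl, substFun₂_inl, map_sum]
    simp_rw [map_mul, polySubst₂_C, polySubst₂_X_inl, Finset.sum_mul, mul_assoc, ← C_mul]
    rw [Finset.sum_comm]
    refine Finset.sum_congr rfl fun c _ => ?_
    rw [← Finset.mul_sum, ← map_sum, Matrix.mul_apply]
  · rw [substFun₂_inr, substFun₂_inr, map_sum]
    simp_rw [map_mul, polySubst₂_C, polySubst₂_X_inr, Finset.sum_mul, mul_assoc, ← C_mul]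
    rw [Finset.sum_comm]
    refine Finset.sum_congr rfl fun c _ => ?_
    rw [← Finset.mul_sum, ← map_sum, Matrix.mul_apply]

/-- `σ_{1,1} = id`. [folklore] -/
theorem polySubst₂_one : polySubst₂ (1 : Matrix (Fin p) (Fin p) K) 1 = AlgHom.id K _ := by
  refine MvPolynomial.algHom_ext fun v => ?_
  rw [polySubst₂_X, AlgHom.id_apply]
  rcases v with ⟨i, a⟩ | ⟨j, a⟩
  · rw [substFun₂_inl, Finset.sum_eq_single a]
    · rw [Matrix.one_apply_eq, C_1, mul_one]
    · intro b _ hb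
      rw [Matrix.one_apply_ne hb, C_0, mul_zero]
    · intro h; exact absurd (Finset.mem_univ a) h
  · rw [substFun₂_inr, Finset.sum_eq_single a]
    · rw [Matrix.one_apply_eq, C_1, mul_one]
    · intro b _ hb
      rw [Matrix.one_apply_ne hb, C_0, mul_zero]
    · intro h; exact absurd (Finset.mem_univ a) h

/-! ## §3 Base change: the coefficients of `σ_{M,N} f` are polynomial in `(M, N)` -/

section BaseChange

variable {K' : Type*} [CommRing K'] (φ : K →+* K')

/-- base change of the substituted variables. [folklore] -/
theorem map_substFun₂ (M N : Matrix (Fin p) (Fin p) K) (v : (Fin 2 × Fin p) ⊕ (Fin 2 × Fin p)) :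
    MvPolynomial.map φ (substFun₂ M N v) = substFun₂ (M.map φ) (N.map φ) v := by
  rcases v with ⟨i, a⟩ | ⟨j, a⟩
  · rw [substFun₂_inl, substFun₂_inl, map_sum]
    refine Finset.sum_congr rfl fun b _ => ?_
    rw [map_mul, map_X, map_C, Matrix.map_apply]
  · rw [substFun₂_inr, substFun₂_inr, map_sum]
    refine Finset.sum_congr rfl fun b _ => ?_
    rw [map_mul, map_X, map_C, Matrix.map_apply]

/-- **BASE CHANGE**: for every ring map `φ : K →+* K′`, `map φ (σ_{M,N} f) = σ_{φ(M), φ(N)} (map φ f)` — i.e. the coefficients of `σ_{M,N} f` are given by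
universal polynomials in the entries of `(M, N)` (take `K :=` a polynomial ring in generic matrix entries and `φ :=` evaluation at a point).
[cite: Weyl1939, Thm. 2.6.A] [cite: Howe1989Remarks, §2] -/
theorem map_polySubst₂ (M N : Matrix (Fin p) (Fin p) K) (f : MvPolynomial ((Fin 2 × Fin p) ⊕ (Fin 2 × Fin p)) K) :
    MvPolynomial.map φ (polySubst₂ M N f) = polySubst₂ (M.map φ) (N.map φ) (MvPolynomial.map φ f) := by
  induction f using MvPolynomial.induction_on with
  | C r => rw [polySubst₂_C, map_C, polySubst₂_C]
  | add f g hf hg => rw [map_add, map_add, hf, hg, map_add, map_add]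
  | mul_X f v hf => rw [map_mul, map_mul, hf, polySubst₂_X, map_substFun₂, map_mul, map_X, map_mul, polySubst₂_X]

end BaseChange

/-! ## §4 Diagonal scaling on a bihomogeneous polynomial -/

/-- the substituted variable for the scalar pair `(c•1, c′•1)`: `x_v ↦ C c · x_v`, `y_v ↦ C c′ · y_v`. [folklore] -/
theorem substFun₂_scalar (c c' : K) (v : (Fin 2 × Fin p) ⊕ (Fin 2 × Fin p)) :
    substFun₂ (c • (1 : Matrix (Fin p) (Fin p) K)) (c' • (1 : Matrix (Fin p) (Fin p) K)) v =
      C (Sum.elim (fun _ => c) (fun _ => c') v) * X v := by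
  rcases v with ⟨i, a⟩ | ⟨j, a⟩
  · rw [substFun₂_inl, Finset.sum_eq_single a, Sum.elim_inl, mul_comm]
    · rw [Matrix.smul_apply, Matrix.one_apply_eq, smul_eq_mul, mul_one]
    · intro b _ hb
      rw [Matrix.smul_apply, Matrix.one_apply_ne hb, smul_zero, C_0, mul_zero]
    · intro h; exact absurd (Finset.mem_univ a) h
  · rw [substFun₂_inr, Finset.sum_eq_single a, Sum.elim_inr, mul_comm]
    · rw [Matrix.smul_apply, Matrix.one_apply_eq, smul_eq_mul, mul_one]
    · intro b _ hb
      rw [Matrix.smul_apply, Matrix.one_apply_ne hb, smul_zero, C_0, mul_zero]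
    · intro h; exact absurd (Finset.mem_univ a) h

/-- the first bidegree of a monomial exponent = its total `x`-degree. [folklore] -/
theorem weight_bideg_fst (m : (Fin 2 × Fin p) ⊕ (Fin 2 × Fin p) →₀ ℕ) :
    (Finsupp.weight (bideg (p := p)) m).1 = ∑ ia : Fin 2 × Fin p, m (Sum.inl ia) := by
  rw [Finsupp.weight_apply, Finsupp.sum_fintype]
  · rw [Prod.fst_sum, Fintype.sum_sum_type]
    simp only [Prod.smul_fst, bideg_inl, bideg_inr, smul_eq_mul, mul_one, mul_zero, Finset.sum_const_zero, add_zero]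
  · intro _; exact zero_smul ℕ _

/-- the second bidegree of a monomial exponent = its total `y`-degree. [folklore] -/
theorem weight_bideg_snd (m : (Fin 2 × Fin p) ⊕ (Fin 2 × Fin p) →₀ ℕ) :
    (Finsupp.weight (bideg (p := p)) m).2 = ∑ ja : Fin 2 × Fin p, m (Sum.inr ja) := by
  rw [Finsupp.weight_apply, Finsupp.sum_fintype]
  · rw [Prod.snd_sum, Fintype.sum_sum_type]
    simp only [Prod.smul_snd, bideg_inl, bideg_inr, smul_eq_mul, mul_one, mul_zero, Finset.sum_const_zero, zero_add]
  · intro _; exact zero_smul ℕ _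

/-- the scaling weight of a monomial: `∏_v (Sum.elim c c′ v)^{m v} = c^d · c′^e` where `(d, e) = weight bideg m`. [folklore] -/
theorem prod_pow_scalar_eq (c c' : K) (m : (Fin 2 × Fin p) ⊕ (Fin 2 × Fin p) →₀ ℕ) :
    (m.prod fun v k => (Sum.elim (fun _ : Fin 2 × Fin p => c) (fun _ : Fin 2 × Fin p => c') v) ^ k) =
      c ^ (Finsupp.weight (bideg (p := p)) m).1 * c' ^ (Finsupp.weight (bideg (p := p)) m).2 := by
  rw [Finsupp.prod_pow, Fintype.prod_sum_type, weight_bideg_fst, weight_bideg_snd]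
  simp only [Sum.elim_inl, Sum.elim_inr, Finset.prod_pow_eq_pow_sum]

/-- **DIAGONAL SCALING ON A BIHOMOGENEOUS POLYNOMIAL**: for `f` of bidegree `(d, e)`, `σ_{c•1, c′•1} f = (c^d · c′^e) · f`. [cite: KashiwaraVergne1978, §II] -/
theorem polySubst₂_scalar_of_isWeightedHomogeneous (c c' : K) {f : MvPolynomial ((Fin 2 × Fin p) ⊕ (Fin 2 × Fin p)) K} {n : ℕ × ℕ}
    (hf : IsWeightedHomogeneous (bideg (p := p)) f n) :
    polySubst₂ (c • (1 : Matrix (Fin p) (Fin p) K)) (c' • (1 : Matrix (Fin p) (Fin p) K)) f = C (c ^ n.1 * c' ^ n.2) * f := by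
  classical
  conv_lhs => rw [f.as_sum]
  conv_rhs => rw [f.as_sum, Finset.mul_sum]
  rw [map_sum]
  refine Finset.sum_congr rfl fun m hm => ?_
  have hmn : Finsupp.weight (bideg (p := p)) m = n := hf (mem_support_iff.1 hm)
  rw [polySubst₂, aeval_monomial, ← hmn, MvPolynomial.algebraMap_eq]
  have hprod : (m.prod fun v k => substFun₂ (c • (1 : Matrix (Fin p) (Fin p) K)) (c' • (1 : Matrix (Fin p) (Fin p) K)) v ^ k) =
      C (c ^ (Finsupp.weight (bideg (p := p)) m).1 * c' ^ (Finsupp.weight (bideg (p := p)) m).2) * m.prod fun v k => X v ^ k := by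
    rw [← prod_pow_scalar_eq c c' m, map_finsuppProd C, ← Finsupp.prod_mul]
    refine Finsupp.prod_congr fun v _ => ?_
    rw [substFun₂_scalar, mul_pow, map_pow]
  rw [hprod, monomial_eq]
  ring

/-- **SCALED MATRICES**: for `f` of bidegree `(d, e)`, `σ_{c•M, c′•N} f = (c^d · c′^e) · σ_{M,N} f` — how the denominators `(det g)⁻¹`, `det(1 + iH)⁻¹` of the
Cayley road clear. [cite: Weyl1939, Thm. 2.6.A] [cite: KashiwaraVergne1978, §II] -/
theorem polySubst₂_smul_of_isWeightedHomogeneous (c c' : K) (M N : Matrix (Fin p) (Fin p) K) {f : MvPolynomial ((Fin 2 × Fin p) ⊕ (Fin 2 × Fin p)) K}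
    {n : ℕ × ℕ} (hf : IsWeightedHomogeneous (bideg (p := p)) f n) :
    polySubst₂ (c • M) (c' • N) f = C (c ^ n.1 * c' ^ n.2) * polySubst₂ M N f := by
  have hM : c • M = M * (c • (1 : Matrix (Fin p) (Fin p) K)) := by rw [Matrix.mul_smul, Matrix.mul_one]
  have hN : c' • N = N * (c' • (1 : Matrix (Fin p) (Fin p) K)) := by rw [Matrix.mul_smul, Matrix.mul_one]
  rw [hM, hN, polySubst₂_mul, AlgHom.comp_apply, polySubst₂_scalar_of_isWeightedHomogeneous c c' hf, map_mul, polySubst₂_C]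

end Summit.HodgeConjecture.HodgeConjecture.Cruxes.HLiu418.K2LiuPolySubstTwoMatrix

end
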